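import Literature.NumberTheory.GaloisRepresentations.SemiLocalArchimedeanShapiro
import Mathlib.RepresentationTheory.Coinduced
import HarnessLib

/-!
# Equivariant homomorphisms into the archimedean semi-local module:
# `Hom_G(X, ∏_{w∣v} E_wˣ) = Hom_{Stab(w₀)}(X, E_{w₀}ˣ)` at an infinite place (Harari §13.1; Brown III (5.8)–(5.9))

Topic `NumberTheory/GaloisRepresentations`; namespace `Literature.NumberTheory.GaloisRepresentations.IdeleReadout`
(`ArchHerbrand` opened).  Definitions with bodies and theorems; NO named fact, no `sorry`, no instance, no notation;
number fields in `Type`.  The archimedean twin of door-c5 g17's `SemiLocalHomAssembly.lean`: Frobenius reciprocity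
(Mathlib `Rep.resCoindHomEquiv`) composed with door-c5's `archUnitsRepIsoCoind w₀ : archUnitsRep v ≅
Coind_{Stab(w₀)}^G E_{w₀}ˣ` (`v = w₀|_F`; the co-induced module is presented through the orbit of `w₀` and Brown's
inherited `Stab`-structure `costabilizerRep`, which IS the transport action `g ↦ g_{w₀}`: `costabilizerRep_arch_apply`).
The local datum is given NAIVELY — an additive `φ : X → E_{w₀}ˣ` with `φ(g x) = g_{w₀}(φ x)` for every `g` fixing `w₀` —
so that consumers never touch the orbit/stabiliser bookkeeping.

Why (Route A of crux `AnticycControlAdditiveK`, item 19295; presentation road (R3) at the infinite places,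
FINDING-door-c6-g16 §5 "archimedean places: F4c applies verbatim").

## What is formalised (`F E : Type`, `[IsGalois F E]`, `G = E ≃ₐ[F] E`, `w₀ : InfinitePlace E`, `v = w₀.comap (algebraMap F E)`,
## `X : Rep ℤ G`)

* `IsStabHom w₀ X φ` (the naive `Stab(w₀)`-equivariance of `φ : X →+ Additive E_{w₀}ˣ`), `archLocalHom` (as a morphism
  `Res_{Stab(w₀ ∈ G·w₀)} X ⟶ costabilizerRep`), **`archAssemble w₀ φ hφ : X ⟶ archUnitsRep (w₀.comap (algebraMap F E))`**,
  `archUnitsRepIsoCoind_hom_apply` (unfolding of door-c5's iso), **`archProj_ρ_archAssemble`**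
  (`(g • Φ x)_{w₀} = φ (g • x)`), **`archProj_archAssemble`** (`(Φ x)_{w₀} = φ x`),
  **`arch_hom_ext_of_archProj_eq`** (a `G`-morphism into `∏_{w∣v} E_wˣ` is determined by its `w₀`-component),
  **`eq_archAssemble_of_archProj_eq`**.
* transport along `w₀|_F = v`: **`archTransport hw Φ : X ⟶ archUnitsRep v`**, `coe_toMul_archTransport_hom`.

## References
* D. Harari, *Galois Cohomology and Class Field Theory* (2020), §13.1 (`I_K(v) = I_G^{G_v}(K_v^*)`, archimedean `v`). [Harari2020]
* K. S. Brown, *Cohomology of Groups*, GTM 87 (1982), III §5 (5.8)–(5.9). [Brown1982CohomologyGroups]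
* J. W. S. Cassels, A. Fröhlich (eds.), *Algebraic Number Theory* (1967), Ch. VII (Tate) §1.1, §7.3. [CasselsFrohlichANT1967]
-/

noncomputable section

open NumberField NumberField.InfinitePlace CategoryTheory
open Literature.NumberTheory.Automorphic

namespace Literature.NumberTheory.GaloisRepresentations

namespace IdeleReadout

open ArchHerbrand Literature.Algebra.Homology

variable {F : Type} [Field F] {E : Type} [Field E] [Algebra F E] [IsGalois F E]
variable (w₀ : InfinitePlace E) {X : Rep.{0} ℤ (E ≃ₐ[F] E)}

/-- **Naive `Stab(w₀)`-equivariance** of an additive `φ : X → E_{w₀}ˣ`: `φ(g x) = g_{w₀}(φ x)` for every `g` with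
`g • w₀ = w₀`. [cite: Harari2020, §13.1 (the `G_v`-modules `K_v^*`)] -/
def IsStabHom (X : Rep.{0} ℤ (E ≃ₐ[F] E)) (φ : X.V →+ Additive (w₀.Completion)ˣ) : Prop :=
  ∀ (g : E ≃ₐ[F] E) (hg : g • w₀ = w₀) (x : X.V),
    ((Additive.toMul (φ (X.ρ g x)) : (w₀.Completion)ˣ) : w₀.Completion) =
      galInfiniteCompletionMap g hg ((Additive.toMul (φ x) : (w₀.Completion)ˣ) : w₀.Completion)

/-- The co-induced presentation's `Stab`-module at the base point (door-c5's `costabilizerRep` datum of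
`archUnitsRepIsoCoind`), as an object of `Rep`. [cite: Brown1982CohomologyGroups, III §5 Prop. (5.8)] -/
abbrev archCostabRep : Rep ℤ (MulAction.stabilizer (E ≃ₐ[F] E) (basePt (F := F) w₀)) :=
  Rep.of (CoinducedModule.costabilizerRep (archUnitsRepr (E := E) (w₀.comap (algebraMap F E)))
    (fun w : MulAction.orbit (E ≃ₐ[F] E) w₀ => archProj (E := E) (w₀.comap (algebraMap F E)) (w : InfinitePlace E))
    (basePt (F := F) w₀) (surjective_archProj w₀ _) (ker_archProj_smul_orbit w₀))

variable {w₀}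

/-- **A naive `Stab(w₀)`-equivariant `φ` as a morphism `Res X ⟶ costabilizerRep`** (the inherited structure is the
transport action, `costabilizerRep_arch_apply`). [cite: Brown1982CohomologyGroups, III §5 Prop. (5.8)] -/
def archLocalHom {φ : X.V →+ Additive (w₀.Completion)ˣ} (hφ : IsStabHom w₀ X φ) :
    Rep.res (MulAction.stabilizer (E ≃ₐ[F] E) (basePt (F := F) w₀)).subtype X ⟶ archCostabRep w₀ :=
  letI : Module ℤ X.V := X.hV2
  Rep.ofHom (ρ := (Rep.res (MulAction.stabilizer (E ≃ₐ[F] E) (basePt (F := F) w₀)).subtype X).ρ)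
    ⟨{ toFun := φ
       map_add' := fun x y => map_add φ x y
       map_smul' := fun c x => map_intCast_smul φ ℤ ℤ c x },
      fun g => LinearMap.ext fun x => Additive.toMul.injective (Units.ext (by
        change ((Additive.toMul (φ (X.ρ (g : E ≃ₐ[F] E) x)) : (w₀.Completion)ˣ) : w₀.Completion) =
          ((Additive.toMul (CoinducedModule.costabilizerRep (archUnitsRepr (E := E) (w₀.comap (algebraMap F E)))
            (fun w : MulAction.orbit (E ≃ₐ[F] E) w₀ => archProj (E := E) (w₀.comap (algebraMap F E)) (w : InfinitePlace E))
            (basePt (F := F) w₀) (surjective_archProj w₀ _) (ker_archProj_smul_orbit w₀) g (φ x)) :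
              (w₀.Completion)ˣ) : w₀.Completion)
        rw [costabilizerRep_arch_apply, coe_toMul_archLocalUnitsRepr]
        exact hφ _ _ x))⟩

/-- Unfolding `archLocalHom`. [cite: Brown1982CohomologyGroups, III §5 Prop. (5.8)] -/
theorem archLocalHom_apply {φ : X.V →+ Additive (w₀.Completion)ˣ} (hφ : IsStabHom w₀ X φ) (x : X.V) :
    (archLocalHom hφ).hom x = φ x := rfl

/-- **The `G`-morphism `X ⟶ ∏_{w∣v} E_wˣ` (`v = w₀|_F`) assembled from a naive `Stab(w₀)`-equivariant `φ : X → E_{w₀}ˣ`**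
(Frobenius reciprocity + `archUnitsRepIsoCoind`). [cite: Harari2020, §13.1] [cite: Brown1982CohomologyGroups, III §5 (5.9)] -/
def archAssemble {φ : X.V →+ Additive (w₀.Completion)ˣ} (hφ : IsStabHom w₀ X φ) :
    X ⟶ archUnitsRep (E := E) (w₀.comap (algebraMap F E)) :=
  (Rep.resCoindHomEquiv.{0, 0, 0, 0} (MulAction.stabilizer (E ≃ₐ[F] E) (basePt (F := F) w₀)).subtype X
    (archCostabRep w₀) (archLocalHom hφ)) ≫ (archUnitsRepIsoCoind w₀).inv

variable (w₀) in
/-- Unfolding of door-c5's `archUnitsRepIsoCoind`: `(iso u)(g) = (g • u)_{w₀}`. [cite: Brown1982CohomologyGroups, III §5 Prop. (5.8)] -/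
theorem archUnitsRepIsoCoind_hom_apply (u : Additive (infUnits E (w₀.comap (algebraMap F E)))) (g : E ≃ₐ[F] E) :
    ((archUnitsRepIsoCoind (F := F) w₀).hom.hom u).1 g =
      archProj (E := E) (w₀.comap (algebraMap F E)) w₀ (archUnitsRepr (E := E) (w₀.comap (algebraMap F E)) g u) := rfl

/-- `archAssemble φ` followed by the iso is the adjunct of `archLocalHom φ`. [cite: Brown1982CohomologyGroups, III §5 (5.9)] -/
theorem archAssemble_comp_iso_hom {φ : X.V →+ Additive (w₀.Completion)ˣ} (hφ : IsStabHom w₀ X φ) :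
    archAssemble hφ ≫ (archUnitsRepIsoCoind (F := F) w₀).hom =
      Rep.resCoindHomEquiv.{0, 0, 0, 0} (MulAction.stabilizer (E ≃ₐ[F] E) (basePt (F := F) w₀)).subtype X
        (archCostabRep w₀) (archLocalHom hφ) := by
  rw [archAssemble, Category.assoc, Iso.inv_hom_id, Category.comp_id]

/-- **`(g • Φ x)_{w₀} = φ (g • x)`** for `Φ = archAssemble φ`. [cite: Brown1982CohomologyGroups, III §5 (5.9)] -/
theorem archProj_ρ_archAssemble {φ : X.V →+ Additive (w₀.Completion)ˣ} (hφ : IsStabHom w₀ X φ) (g : E ≃ₐ[F] E)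
    (x : X.V) :
    archProj (E := E) (w₀.comap (algebraMap F E)) w₀
        ((archUnitsRep (E := E) (w₀.comap (algebraMap F E))).ρ g ((archAssemble hφ).hom x)) = φ (X.ρ g x) := by
  have h := congrArg (fun ψ : X ⟶ Rep.coind (MulAction.stabilizer (E ≃ₐ[F] E) (basePt (F := F) w₀)).subtype
    (archCostabRep w₀) => (ψ.hom x).1 g) (archAssemble_comp_iso_hom hφ)
  dsimp only at h
  rw [Rep.comp_apply, archUnitsRepIsoCoind_hom_apply, Rep.resCoindHomEquiv_apply, Rep.resCoindToHom_hom_apply_coe] at h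
  exact h

/-- **`(Φ x)_{w₀} = φ x`.** [cite: Brown1982CohomologyGroups, III §5 (5.9)] -/
theorem archProj_archAssemble {φ : X.V →+ Additive (w₀.Completion)ˣ} (hφ : IsStabHom w₀ X φ) (x : X.V) :
    archProj (E := E) (w₀.comap (algebraMap F E)) w₀ ((archAssemble hφ).hom x) = φ x := by
  letI : Module ℤ X.V := X.hV2
  have h := archProj_ρ_archAssemble hφ 1 x
  rwa [map_one, map_one, Module.End.one_apply, Module.End.one_apply] at h

/-- The `w₀`-component of a `G`-morphism `Φ : X ⟶ ∏_{w∣v} E_wˣ` as the inverse adjunct (a morphism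
`Res X ⟶ costabilizerRep`). [cite: Brown1982CohomologyGroups, III §5 (5.9)] -/
def archLocalComponent (Φ : X ⟶ archUnitsRep (E := E) (w₀.comap (algebraMap F E))) :
    Rep.res (MulAction.stabilizer (E ≃ₐ[F] E) (basePt (F := F) w₀)).subtype X ⟶ archCostabRep w₀ :=
  (Rep.resCoindHomEquiv.{0, 0, 0, 0} (MulAction.stabilizer (E ≃ₐ[F] E) (basePt (F := F) w₀)).subtype X
    (archCostabRep w₀)).symm (Φ ≫ (archUnitsRepIsoCoind (F := F) w₀).hom)

/-- `archLocalComponent Φ x = (Φ x)_{w₀}`. [cite: Brown1982CohomologyGroups, III §5 (5.9)] -/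
theorem archLocalComponent_apply (Φ : X ⟶ archUnitsRep (E := E) (w₀.comap (algebraMap F E))) (x : X.V) :
    (archLocalComponent (w₀ := w₀) Φ).hom x = archProj (E := E) (w₀.comap (algebraMap F E)) w₀ (Φ.hom x) := by
  change ((Φ ≫ (archUnitsRepIsoCoind (F := F) w₀).hom).hom x).1 1 = _
  rw [Rep.comp_apply, archUnitsRepIsoCoind_hom_apply, map_one, Module.End.one_apply]

/-- `archAssemble`-type reconstruction: `Φ = adjunct⁻¹ (archLocalComponent Φ)`. [cite: Brown1982CohomologyGroups, III §5 (5.9)] -/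
theorem eq_of_archLocalComponent (Φ : X ⟶ archUnitsRep (E := E) (w₀.comap (algebraMap F E))) :
    (Rep.resCoindHomEquiv.{0, 0, 0, 0} (MulAction.stabilizer (E ≃ₐ[F] E) (basePt (F := F) w₀)).subtype X
      (archCostabRep w₀) (archLocalComponent (w₀ := w₀) Φ)) ≫ (archUnitsRepIsoCoind (F := F) w₀).inv = Φ := by
  rw [archLocalComponent, LinearEquiv.apply_symm_apply, Category.assoc, Iso.hom_inv_id, Category.comp_id]

/-- **A `G`-morphism into `∏_{w∣v} E_wˣ` is determined by its `w₀`-component.** [cite: Brown1982CohomologyGroups, III §5 (5.9)] -/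
theorem arch_hom_ext_of_archProj_eq {Φ Ψ : X ⟶ archUnitsRep (E := E) (w₀.comap (algebraMap F E))}
    (h : ∀ x : X.V, archProj (E := E) (w₀.comap (algebraMap F E)) w₀ (Φ.hom x) =
      archProj (E := E) (w₀.comap (algebraMap F E)) w₀ (Ψ.hom x)) : Φ = Ψ := by
  have hc : archLocalComponent (w₀ := w₀) Φ = archLocalComponent (w₀ := w₀) Ψ := by
    letI : Module ℤ X.V := X.hV2
    refine Rep.hom_ext (Representation.IntertwiningMap.ext (LinearMap.ext fun x => ?_))
    change (archLocalComponent (w₀ := w₀) Φ).hom x = (archLocalComponent (w₀ := w₀) Ψ).hom x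
    rw [archLocalComponent_apply, archLocalComponent_apply, h]
  rw [← eq_of_archLocalComponent (w₀ := w₀) Φ, hc, eq_of_archLocalComponent]

/-- A `G`-morphism whose `w₀`-component is `φ` is `archAssemble φ`. [cite: Brown1982CohomologyGroups, III §5 (5.9)] -/
theorem eq_archAssemble_of_archProj_eq {φ : X.V →+ Additive (w₀.Completion)ˣ} (hφ : IsStabHom w₀ X φ)
    {Ψ : X ⟶ archUnitsRep (E := E) (w₀.comap (algebraMap F E))}
    (h : ∀ x : X.V, archProj (E := E) (w₀.comap (algebraMap F E)) w₀ (Ψ.hom x) = φ x) : Ψ = archAssemble hφ :=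
  arch_hom_ext_of_archProj_eq fun x => by rw [h, archProj_archAssemble]

/-! ## Transport along `w₀|_F = v` -/

omit [IsGalois F E] in
/-- **Transport of a morphism into `archUnitsRep (w₀|_F)` to `archUnitsRep v` along `w₀ ∣ v`.**
[cite: CasselsFrohlichANT1967, Ch. VII §7.3] -/
def archTransport {v : InfinitePlace F} (hw : IsOver E v w₀) (Φ : X ⟶ archUnitsRep (E := E) (w₀.comap (algebraMap F E))) :
    X ⟶ archUnitsRep (E := E) v :=
  hw ▸ Φ

omit [IsGalois F E] in
/-- The transport does not change the underlying archimedean idèle. [cite: CasselsFrohlichANT1967, Ch. VII §7.3] -/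
theorem coe_toMul_archTransport_hom {v : InfinitePlace F} (hw : IsOver E v w₀)
    (Φ : X ⟶ archUnitsRep (E := E) (w₀.comap (algebraMap F E))) (x : X.V) :
    ((Additive.toMul (α := infUnits E v) ((archTransport hw Φ).hom x) : infUnits E v) : (InfiniteAdeleRing E)ˣ) =
      ((Additive.toMul (α := infUnits E (w₀.comap (algebraMap F E))) (Φ.hom x) :
        infUnits E (w₀.comap (algebraMap F E))) : (InfiniteAdeleRing E)ˣ) := by
  subst hw
  rfl

omit [IsGalois F E] in
/-- In particular the `w₀`-component is unchanged: `(archTransport Φ x)_{w₀} = (Φ x)_{w₀}` in `E_{w₀}`.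
[cite: CasselsFrohlichANT1967, Ch. VII §7.3] -/
theorem coe_toMul_archProj_archTransport {v : InfinitePlace F} (hw : IsOver E v w₀)
    (Φ : X ⟶ archUnitsRep (E := E) (w₀.comap (algebraMap F E))) (x : X.V) (w : InfinitePlace E) :
    ((Additive.toMul (archProj (E := E) v w ((archTransport hw Φ).hom x)) : (w.Completion)ˣ) : w.Completion) =
      ((Additive.toMul (archProj (E := E) (w₀.comap (algebraMap F E)) w (Φ.hom x)) : (w.Completion)ˣ) : w.Completion) := by
  subst hw
  rfl

end IdeleReadout

end Literature.NumberTheory.GaloisRepresentations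

end
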